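import Summits.BirchSwinnertonDyer.BirchSwinnertonDyer.Theorems.PrintCf2SplitBadEisensteinTwoDivisibilitiesHalfDescentCore
import HarnessLib

/-!
# Crux `PrintCf2.SplitBadTwoRankOneOfFacts` (item 20368), line `eisenstein_two_bdp_line` v9 — ONE-SIDED DESCENT (part 2, the route):
# `stub_upperDivisibility_two` ALONE (with prints, Milne, frames, socket, twin) ⟹ the Euler-system HALF `ord₂ #Ш(W) ≤ ord₂ #Ш_an(W)` of
# `BSD₂(W)`; `stub_lowerDivisibility_two` ALONE ⟹ the Eisenstein HALF — for ONE class member (route theorems)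

Cell `bsd-print-cf2`, seat `bsd-line-cf2-p1` g7 (LEAD on crux stmt-BirchSwinnertonDyer-20368). `--supports stmt-BirchSwinnertonDyer-20368`
(helper). Theses-free (imports only Theorems + P2); THEOREMS ONLY (0 definitions, 0 named facts, 0 `sorry`); CONDITIONAL on every displayed
hypothesis. BSD is proved for no curve by any of this; no summit statement is proved by this seat.

The two-sided row kernel (p629097 `bsdp_two_of_divisibilities_of_socket_of_twist`) needs BOTH one-sided v9 stubs. Here each stub is shown to
be productive ON ITS OWN: the route (parity ⟹ Friedberg–Hoffstein field `K` mod `6` ⟹ Heegner point ⟹ Kolyvagin ⟹ control socket FIRST ⟹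
frame) is the kernel's, then part 1 (p`…HalfDescentCore`): the one-sided `K`-side input (`upperOver_of_upperDivisibility_two` /
`lowerOver_of_lowerDivisibility_two`) and the one-sided Milne descent with the twin's exact `BSD₂` (Burungale–Flach in the line).
* `missingUpperBoundAt_two_of_upperDivisibility_of_socket_of_twist` — UPPER ⟹ `MissingUpperBoundAt W 2` (Kolyvagin's half at the split
  additive `2` for the CM class — not in print);
* `missingLowerBoundAt_two_of_lowerDivisibility_of_socket_of_twist` — LOWER ⟹ `MissingLowerBoundAt W 2`;
both halves ⟹ `MissingPPartAt W 2` ⟹ `BSDp W 2` (`missingPPartAt_of_lower_of_upper`, `bsdp_of_missingPPartAt`), recovering p629097.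

References: [Kolyvagin1990] Thm. A; [JetchevSkinnerWan2017] §7.4.1, Thm. 3.3.1; [Milne1972ArithmeticAV] §1 Thm. 1; [GrossZagier1986] V.(2.2);
[FriedbergHoffstein1995] Thm. B; [Miller2011LMS] Def. 1.1.
-/

set_option autoImplicit false

-- D-0017 layout: summit = sub-problem, so `Summit.BirchSwinnertonDyer.BirchSwinnertonDyer.…` is the mandated namespace of Theorems files.
set_option linter.dupNamespace false

noncomputable section

open scoped Classical MatrixGroups ModularForm Topology NumberField

namespace Summit.BirchSwinnertonDyer.BirchSwinnertonDyer.Theorems.PrintCf2.EisensteinTwo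

open Filter CongruenceSubgroup WeierstrassCurve NumberField IsDedekindDomain Field PowerSeries
  Literature.NumberTheory.EllipticCurves Literature.NumberTheory.EllipticCurves.ModularForms
  Literature.NumberTheory.EllipticCurves.LiuZhangZhang2018 Literature.NumberTheory.EllipticCurves.Rank1Residual
  Literature.NumberTheory.EllipticCurves.Rank1Residual.Typed Literature.NumberTheory.EllipticCurves.KrizLi2019
  Literature.NumberTheory.GaloisRepresentations Literature.NumberTheory.GaloisCohomology
  Summit.BirchSwinnertonDyer.Rank1Residual Summit.BirchSwinnertonDyer.Rank1Residual.X11b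
  Summit.BirchSwinnertonDyer.Rank1Residual.X11b.AcSelmer Summit.BirchSwinnertonDyer.Rank1Residual.X11b.CongruenceLimit
  Summit.BirchSwinnertonDyer.Rank1Residual.X11b.Halves Summit.BirchSwinnertonDyer.Rank1Residual.X2
  Summit.BirchSwinnertonDyer.Rank1Residual.Additive Summit.BirchSwinnertonDyer.Rank1Residual.AdditivePotMult
  Summit.BirchSwinnertonDyer.BirchSwinnertonDyer.Theses.UniversalToricDescent
  Summit.BirchSwinnertonDyer.BirchSwinnertonDyer.Theorems.UniversalToricDescentWaldspurgerFlat

/-! ### §3 The route: one class member, one half each -/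

/-- **THE EULER-SYSTEM HALF OF `BSD₂(W)` FROM THE UPPER DIVISIBILITY ALONE.** For ONE globally minimal `W/ℚ` with `4 ∣ N_W` and
`r_an(W) = 1`, GIVEN `hF`, `hL`, `hMilne`; `hFr` the UN-HALVED frames; `hUp` the UPPER divisibility at every frame (the body of the registered v9
stub `stub_upperDivisibility_two` for this `W`); `hTw` the twin's `BSD₂`; `hCtl₀` the control socket — and NO lower divisibility — THEN
`MissingUpperBoundAt W 2`: `#Ш_an(W)` is rational and `ord₂ #Ш(W) ≤ ord₂ #Ш_an(W)` (Kolyvagin's half of the `2`-part of BSD). Route = the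
two-sided kernel's (p629097) up to the frame; then part 1's `upperOver_of_upperDivisibility_two` + `missingUpperBoundAt_of_upperOver_of_bsdp_twist`.
[cite: Kolyvagin1990, Thm. A (shape)] [cite: Milne1972ArithmeticAV, §1 Thm. 1] [cite: GrossZagier1986, V.(2.2)] [cite: FriedbergHoffstein1995, Thm. B] -/
theorem missingUpperBoundAt_two_of_upperDivisibility_of_socket_of_twist
    (hF : ToricPublishedInputs) (hL : thm151_thm153_modularCurve_heegnerVector_additive)
    (hMilne : Milne1972.bsdQuotient_baseChange_quadratic)
    (W : WeierstrassCurve ℚ) [W.IsElliptic] [W.IsGloballyMinimal] (h4N : 2 ^ 2 ∣ W.conductorNorm ℤ) (hr : W.analyticRank = 1)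
    (hFr : ∀ (N : ℕ) [NeZero N] (K : Type) [Field K] [NumberField K] (Dt : ModularParametrizationData W N),
      W.conductorNorm ℤ = N → IsImaginaryQuadratic K → SatisfiesHeegnerHypothesis N K →
      ∀ (κ : ZpExtension K 2), κ.IsAnticyclotomic → ∀ (γ : Field.absoluteGaloisGroup K) [Fact (κ.IsTopGenerator γ)]
        (𝔭 : HeightOneSpectrum (𝓞 K)), ((2 : ℕ) : 𝓞 K) ∈ 𝔭.asIdeal → 𝔭.asIdeal.ramificationIdx (𝓞 ℚ) = 1 →
        𝔭.asIdeal.inertiaDeg (𝓞 ℚ) = 1 → ∀ (ι' : PadicAlgCl 2 ≃+* ℂ), SchneiderFree.BranchInducesPrime 2 ι' 𝔭 →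
        ∃ (ΩK : ℂ) (Ωp : ℂ_[2]) (Q : PowerSeries (PadicComplexInt 2)),
          ΩK ≠ 0 ∧ Ωp ≠ 0 ∧ R1.IsBDPLFunctionInt 2 ι' 𝔭 κ γ Dt.f ΩK Ωp Q)
    (hUp : ∀ (N : ℕ) [NeZero N] (K : Type) [Field K] [NumberField K] (Dt : ModularParametrizationData W N),
      W.conductorNorm ℤ = N → IsImaginaryQuadratic K → SatisfiesHeegnerHypothesis N K →
      ∀ (κ : ZpExtension K 2), κ.IsAnticyclotomic → ∀ (γ : Field.absoluteGaloisGroup K) [Fact (κ.IsTopGenerator γ)]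
        (𝔭 : HeightOneSpectrum (𝓞 K)), ((2 : ℕ) : 𝓞 K) ∈ 𝔭.asIdeal → 𝔭.asIdeal.ramificationIdx (𝓞 ℚ) = 1 →
        𝔭.asIdeal.inertiaDeg (𝓞 ℚ) = 1 → ∀ (𝔭' : HeightOneSpectrum (𝓞 K)), ((2 : ℕ) : 𝓞 K) ∈ 𝔭'.asIdeal → 𝔭' ≠ 𝔭 →
        ∀ (ι' : PadicAlgCl 2 ≃+* ℂ), SchneiderFree.BranchInducesPrime 2 ι' 𝔭 →
        ∀ (ΩK : ℂ) (Ωp : ℂ_[2]) (Q : PowerSeries (PadicComplexInt 2)), ΩK ≠ 0 → Ωp ≠ 0 →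
          R1.IsBDPLFunctionInt 2 ι' 𝔭 κ γ Dt.f ΩK Ωp Q →
          Module.IsTorsion (IwasawaAlgebra 2) (XAc (W.baseChange K) 2 κ 𝔭' ∅ γ) →
          ∃ h : PowerSeries (PadicComplexInt 2), ‖((constantCoeff h : PadicComplexInt 2) : ℂ_[2])‖ ≤ 2⁻¹ ∧
            Ideal.span {Q} ≤ Ideal.span {h} * (XAc.charIdeal (W.baseChange K) 2 κ 𝔭' ∅ γ).map (PowerSeries.map (R1.toCpInt 2)))
    (hTw : ∀ (N : ℕ) [NeZero N] (K : Type) [Field K] [NumberField K]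
      (Wd : WeierstrassCurve ℚ) [Wd.IsElliptic] [Wd.IsGloballyMinimal],
      W.conductorNorm ℤ = N → IsImaginaryQuadratic K → SatisfiesHeegnerHypothesis N K →
      (∃ C : VariableChange ℚ, C • W.quadraticTwist (NumberField.discr K : ℚ) = Wd) →
      (W.quadraticTwist (NumberField.discr K : ℚ)).entireLFunction 1 ≠ 0 → BSDp Wd 2)
    (hCtl₀ : ∀ (N : ℕ) [NeZero N] (K : Type) [Field K] [NumberField K] (Dt : ModularParametrizationData W N)
      (H : HeegnerDatum N (NumberField.discr K)) (ι : K →+* ℂ) (P : (W.baseChange K).toAffine.Point),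
      W.conductorNorm ℤ = N → IsImaginaryQuadratic K → SatisfiesHeegnerHypothesis N K →
      (W.quadraticTwist (NumberField.discr K : ℚ)).entireLFunction 1 ≠ 0 →
      WeierstrassCurve.Affine.Point.map ι.toRatAlgHom P = heegnerPointComplex Dt H → ¬ IsOfFinAddOrder P →
      Literature.NumberTheory.EllipticCurves.kolyvagin N W K →
      ∀ (κ : ZpExtension K 2), κ.IsAnticyclotomic → ∀ (γ : Field.absoluteGaloisGroup K) [Fact (κ.IsTopGenerator γ)]
        (𝔭 : HeightOneSpectrum (𝓞 K)) (h𝔭 : ((2 : ℕ) : 𝓞 K) ∈ 𝔭.asIdeal) (he : 𝔭.asIdeal.ramificationIdx (𝓞 ℚ) = 1)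
        (hf : 𝔭.asIdeal.inertiaDeg (𝓞 ℚ) = 1),
        SchneiderFree.AdditiveControlOnTreeAt 2 κ 𝔭 γ (embAt K 2 𝔭 h𝔭 he hf) P) :
    MissingUpperBoundAt W 2 := by
  obtain ⟨hGZ, hKo, hGZK, hmod, hmodP, -, hGZ73, hFH, hpar, hHP⟩ := hF
  haveI hN0 : NeZero (W.conductorNorm ℤ) := ⟨W.conductorNorm_pos_holds.ne'⟩
  ------------------------------------------------------------------ parity and the Friedberg–Hoffstein field (modulus `6`)
  have hw : W.rootNumber = -1 := by
    rcases W.rootNumber_eq_one_or with h | h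
    · exfalso
      have heven : Even W.analyticRank := (hpar W).mpr h
      rw [hr] at heven
      exact Nat.not_even_one heven
    · exact h
  obtain ⟨K, _, _, hK, -, hHN, hH6, hLt⟩ := hFH W hw 6 (by norm_num) 0
  have hd4 : NumberField.discr K < -4 :=
    discr_lt_neg_four_of_three_split hK (hH6 3 Nat.prime_three (by norm_num : (3 : ℕ) ∣ 6))
  have h2N : (2 : ℕ) ∣ W.conductorNorm ℤ := dvd_trans (dvd_pow_self 2 two_ne_zero) h4N
  have hsplit : SplitsIn K 2 := hHN 2 Nat.prime_two h2N
  ------------------------------------------------------------------ the Heegner point, non-torsion, Kolyvagin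
  obtain ⟨P, Dt, H, ι, hP⟩ := hHP W K hK hHN
  have hL0 : W.entireLFunction 1 = 0 := entireLFunction_one_eq_zero_of_analyticRank_eq_one hr
  obtain ⟨-, hderiv⟩ := leadingLCoeff_eq_deriv_of_analyticRank_eq_one hr
  have hLK : LDerivEK W K ≠ 0 := by
    rw [lDerivEK_eq_deriv_mul W K hmod hL0]; exact mul_ne_zero hderiv hLt
  have hnt : ¬ IsOfFinAddOrder P :=
    (lDerivEK_ne_zero_iff_not_isOfFinAddOrder W (W.conductorNorm ℤ) K (hGZ _ W K) hK hHN ⟨Dt, H, ι, hP⟩).mp hLK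
  have hKoK : Literature.NumberTheory.EllipticCurves.kolyvagin (W.conductorNorm ℤ) W K := hKo _ W K
  obtain ⟨hrk, hfinK⟩ := hKoK hK hHN ⟨Dt, H, ι, hP⟩ hnt
  ------------------------------------------------------------------ the anticyclotomic frame data at `2`
  obtain ⟨κ, γ, -, hκ, hγ, -⟩ := X11b.exists_anticyclotomic_generator_prime (p := 2) hK
  haveI : Fact (κ.IsTopGenerator γ) := ⟨hγ⟩
  obtain ⟨𝔭, h𝔭, he, hf⟩ := X11b.exists_degreeOnePrime_of_splitsIn K 2 hK.1 hsplit
  obtain ⟨𝔭', hne, h𝔭', he', hf'⟩ := X11b.Three.exists_ne_degreeOne_prime hK.1 h𝔭 he hf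
  obtain ⟨ι₀⟩ := PadicAlgCl.nonempty_ringEquiv_complex 2
  obtain ⟨ι', -, hind⟩ := exists_datum_forall_mem_iff 2 ι₀ hK h𝔭
  ------------------------------------------------------------------ socket FIRST (it carries torsion), frame
  have hctl := hCtl₀ (W.conductorNorm ℤ) K Dt H ι P rfl hK hHN hLt hP hnt hKoK κ hκ γ 𝔭' h𝔭' he' hf'
  have htors : Module.IsTorsion (IwasawaAlgebra 2) (XAc (W.baseChange K) 2 κ 𝔭' ∅ γ) := by
    obtain ⟨n, hn, -⟩ := hctl
    exact hn.1
  obtain ⟨ΩK, Ωp, Q, hΩK, hΩp, hQ⟩ := hFr (W.conductorNorm ℤ) K Dt rfl hK hHN κ hκ γ 𝔭 h𝔭 he hf ι' hind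
  ------------------------------------------------------------------ ranks of the pair and the twin
  have h2 : Module.finrank ℚ K = 2 := hK.1
  haveI : (W.baseChange K).IsGloballyMinimal := W.isGloballyMinimal_baseChange_of_satisfiesHeegnerHypothesis K h2 hHN
  have hD0 : (NumberField.discr K : ℚ) ≠ 0 := by exact_mod_cast NumberField.discr_ne_zero K
  haveI hEt : (W.quadraticTwist (NumberField.discr K : ℚ)).IsElliptic := W.isElliptic_quadraticTwist hD0
  have hrd0 : (W.quadraticTwist (NumberField.discr K : ℚ)).analyticRank = 0 :=
    ((W.quadraticTwist (NumberField.discr K : ℚ)).analyticRank_eq_zero_iff_holds (hmod _)).mpr hLt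
  have hrK : (W.baseChange K).analyticRank = 1 :=
    (Summit.BirchSwinnertonDyer.Rank1Residual.P2.analyticRank_baseChange_eq_one_iff W K hmod h2).mpr (Or.inl ⟨hr, hrd0⟩)
  obtain ⟨Cd, hCd⟩ := hasGlobalMinimalModel_rat_holds (W.quadraticTwist (NumberField.discr K : ℚ))
  haveI : (Cd • W.quadraticTwist (NumberField.discr K : ℚ)).IsGloballyMinimal := hCd
  have hWd : BSDp (Cd • W.quadraticTwist (NumberField.discr K : ℚ)) 2 :=
    hTw (W.conductorNorm ℤ) K (Cd • W.quadraticTwist (NumberField.discr K : ℚ)) rfl hK hHN ⟨Cd, rfl⟩ hLt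
  have hrW : W.analyticRank ≤ 1 := by rw [hr]
  have hrd : (Cd • W.quadraticTwist (NumberField.discr K : ℚ)).analyticRank ≤ 1 := by
    rw [analyticRank_smul, hrd0]; exact zero_le_one
  ------------------------------------------------------------------ the one-sided `K`-side input and the one-sided descent
  have hUp₁ := hUp (W.conductorNorm ℤ) K Dt rfl hK hHN κ hκ γ 𝔭 h𝔭 he hf 𝔭' h𝔭' hne ι' hind ΩK Ωp Q hΩK hΩp hQ htors
  have hKup := upperOver_of_upperDivisibility_two hL hmod W K κ γ Dt H ι P (hGZ _ W K) hKoK rfl h4N hK hd4 hHN hκ hP hnt hrk hrK 𝔭 h𝔭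
    he hf 𝔭' h𝔭' he' hf' ι' hind hΩK hΩp hQ hUp₁ hctl
  exact missingUpperBoundAt_of_upperOver_of_bsdp_twist W 2 K (Cd • W.quadraticTwist (NumberField.discr K : ℚ)) (W.baseChange K)
    hGZK hmod hMilne hrW h2 ⟨Cd, rfl⟩ hrd ⟨1, one_smul _ _⟩ hKup hWd

/-- **THE EISENSTEIN HALF OF `BSD₂(W)` FROM THE LOWER DIVISIBILITY ALONE.** Same data with `hLo` the LOWER divisibility (the body of the
registered v9 stub `stub_lowerDivisibility_two` for this `W`) and no upper divisibility: THEN `MissingLowerBoundAt W 2`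
(`ord₂ #Ш_an(W) ≤ ord₂ #Ш(W)`). [cite: JetchevSkinnerWan2017, §7.4.1 (shape)] [cite: Milne1972ArithmeticAV, §1 Thm. 1] [cite: GrossZagier1986, V.(2.2)]
[cite: FriedbergHoffstein1995, Thm. B] -/
theorem missingLowerBoundAt_two_of_lowerDivisibility_of_socket_of_twist
    (hF : ToricPublishedInputs) (hL : thm151_thm153_modularCurve_heegnerVector_additive)
    (hMilne : Milne1972.bsdQuotient_baseChange_quadratic)
    (W : WeierstrassCurve ℚ) [W.IsElliptic] [W.IsGloballyMinimal] (h4N : 2 ^ 2 ∣ W.conductorNorm ℤ) (hr : W.analyticRank = 1)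
    (hFr : ∀ (N : ℕ) [NeZero N] (K : Type) [Field K] [NumberField K] (Dt : ModularParametrizationData W N),
      W.conductorNorm ℤ = N → IsImaginaryQuadratic K → SatisfiesHeegnerHypothesis N K →
      ∀ (κ : ZpExtension K 2), κ.IsAnticyclotomic → ∀ (γ : Field.absoluteGaloisGroup K) [Fact (κ.IsTopGenerator γ)]
        (𝔭 : HeightOneSpectrum (𝓞 K)), ((2 : ℕ) : 𝓞 K) ∈ 𝔭.asIdeal → 𝔭.asIdeal.ramificationIdx (𝓞 ℚ) = 1 →
        𝔭.asIdeal.inertiaDeg (𝓞 ℚ) = 1 → ∀ (ι' : PadicAlgCl 2 ≃+* ℂ), SchneiderFree.BranchInducesPrime 2 ι' 𝔭 →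
        ∃ (ΩK : ℂ) (Ωp : ℂ_[2]) (Q : PowerSeries (PadicComplexInt 2)),
          ΩK ≠ 0 ∧ Ωp ≠ 0 ∧ R1.IsBDPLFunctionInt 2 ι' 𝔭 κ γ Dt.f ΩK Ωp Q)
    (hLo : ∀ (N : ℕ) [NeZero N] (K : Type) [Field K] [NumberField K] (Dt : ModularParametrizationData W N),
      W.conductorNorm ℤ = N → IsImaginaryQuadratic K → SatisfiesHeegnerHypothesis N K →
      ∀ (κ : ZpExtension K 2), κ.IsAnticyclotomic → ∀ (γ : Field.absoluteGaloisGroup K) [Fact (κ.IsTopGenerator γ)]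
        (𝔭 : HeightOneSpectrum (𝓞 K)), ((2 : ℕ) : 𝓞 K) ∈ 𝔭.asIdeal → 𝔭.asIdeal.ramificationIdx (𝓞 ℚ) = 1 →
        𝔭.asIdeal.inertiaDeg (𝓞 ℚ) = 1 → ∀ (𝔭' : HeightOneSpectrum (𝓞 K)), ((2 : ℕ) : 𝓞 K) ∈ 𝔭'.asIdeal → 𝔭' ≠ 𝔭 →
        ∀ (ι' : PadicAlgCl 2 ≃+* ℂ), SchneiderFree.BranchInducesPrime 2 ι' 𝔭 →
        ∀ (ΩK : ℂ) (Ωp : ℂ_[2]) (Q : PowerSeries (PadicComplexInt 2)), ΩK ≠ 0 → Ωp ≠ 0 →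
          R1.IsBDPLFunctionInt 2 ι' 𝔭 κ γ Dt.f ΩK Ωp Q →
          Module.IsTorsion (IwasawaAlgebra 2) (XAc (W.baseChange K) 2 κ 𝔭' ∅ γ) →
          ∃ g : PowerSeries (PadicComplexInt 2), 2⁻¹ ≤ ‖((constantCoeff g : PadicComplexInt 2) : ℂ_[2])‖ ∧
            Ideal.span {g} * (XAc.charIdeal (W.baseChange K) 2 κ 𝔭' ∅ γ).map (PowerSeries.map (R1.toCpInt 2)) ≤ Ideal.span {Q})
    (hTw : ∀ (N : ℕ) [NeZero N] (K : Type) [Field K] [NumberField K]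
      (Wd : WeierstrassCurve ℚ) [Wd.IsElliptic] [Wd.IsGloballyMinimal],
      W.conductorNorm ℤ = N → IsImaginaryQuadratic K → SatisfiesHeegnerHypothesis N K →
      (∃ C : VariableChange ℚ, C • W.quadraticTwist (NumberField.discr K : ℚ) = Wd) →
      (W.quadraticTwist (NumberField.discr K : ℚ)).entireLFunction 1 ≠ 0 → BSDp Wd 2)
    (hCtl₀ : ∀ (N : ℕ) [NeZero N] (K : Type) [Field K] [NumberField K] (Dt : ModularParametrizationData W N)
      (H : HeegnerDatum N (NumberField.discr K)) (ι : K →+* ℂ) (P : (W.baseChange K).toAffine.Point),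
      W.conductorNorm ℤ = N → IsImaginaryQuadratic K → SatisfiesHeegnerHypothesis N K →
      (W.quadraticTwist (NumberField.discr K : ℚ)).entireLFunction 1 ≠ 0 →
      WeierstrassCurve.Affine.Point.map ι.toRatAlgHom P = heegnerPointComplex Dt H → ¬ IsOfFinAddOrder P →
      Literature.NumberTheory.EllipticCurves.kolyvagin N W K →
      ∀ (κ : ZpExtension K 2), κ.IsAnticyclotomic → ∀ (γ : Field.absoluteGaloisGroup K) [Fact (κ.IsTopGenerator γ)]
        (𝔭 : HeightOneSpectrum (𝓞 K)) (h𝔭 : ((2 : ℕ) : 𝓞 K) ∈ 𝔭.asIdeal) (he : 𝔭.asIdeal.ramificationIdx (𝓞 ℚ) = 1)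
        (hf : 𝔭.asIdeal.inertiaDeg (𝓞 ℚ) = 1),
        SchneiderFree.AdditiveControlOnTreeAt 2 κ 𝔭 γ (embAt K 2 𝔭 h𝔭 he hf) P) :
    MissingLowerBoundAt W 2 := by
  obtain ⟨hGZ, hKo, hGZK, hmod, hmodP, -, hGZ73, hFH, hpar, hHP⟩ := hF
  haveI hN0 : NeZero (W.conductorNorm ℤ) := ⟨W.conductorNorm_pos_holds.ne'⟩
  ------------------------------------------------------------------ parity and the Friedberg–Hoffstein field (modulus `6`)
  have hw : W.rootNumber = -1 := by
    rcases W.rootNumber_eq_one_or with h | h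
    · exfalso
      have heven : Even W.analyticRank := (hpar W).mpr h
      rw [hr] at heven
      exact Nat.not_even_one heven
    · exact h
  obtain ⟨K, _, _, hK, -, hHN, hH6, hLt⟩ := hFH W hw 6 (by norm_num) 0
  have hd4 : NumberField.discr K < -4 :=
    discr_lt_neg_four_of_three_split hK (hH6 3 Nat.prime_three (by norm_num : (3 : ℕ) ∣ 6))
  have h2N : (2 : ℕ) ∣ W.conductorNorm ℤ := dvd_trans (dvd_pow_self 2 two_ne_zero) h4N
  have hsplit : SplitsIn K 2 := hHN 2 Nat.prime_two h2N
  ------------------------------------------------------------------ the Heegner point, non-torsion, Kolyvagin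
  obtain ⟨P, Dt, H, ι, hP⟩ := hHP W K hK hHN
  have hL0 : W.entireLFunction 1 = 0 := entireLFunction_one_eq_zero_of_analyticRank_eq_one hr
  obtain ⟨-, hderiv⟩ := leadingLCoeff_eq_deriv_of_analyticRank_eq_one hr
  have hLK : LDerivEK W K ≠ 0 := by
    rw [lDerivEK_eq_deriv_mul W K hmod hL0]; exact mul_ne_zero hderiv hLt
  have hnt : ¬ IsOfFinAddOrder P :=
    (lDerivEK_ne_zero_iff_not_isOfFinAddOrder W (W.conductorNorm ℤ) K (hGZ _ W K) hK hHN ⟨Dt, H, ι, hP⟩).mp hLK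
  have hKoK : Literature.NumberTheory.EllipticCurves.kolyvagin (W.conductorNorm ℤ) W K := hKo _ W K
  obtain ⟨hrk, hfinK⟩ := hKoK hK hHN ⟨Dt, H, ι, hP⟩ hnt
  ------------------------------------------------------------------ the anticyclotomic frame data at `2`
  obtain ⟨κ, γ, -, hκ, hγ, -⟩ := X11b.exists_anticyclotomic_generator_prime (p := 2) hK
  haveI : Fact (κ.IsTopGenerator γ) := ⟨hγ⟩
  obtain ⟨𝔭, h𝔭, he, hf⟩ := X11b.exists_degreeOnePrime_of_splitsIn K 2 hK.1 hsplit
  obtain ⟨𝔭', hne, h𝔭', he', hf'⟩ := X11b.Three.exists_ne_degreeOne_prime hK.1 h𝔭 he hf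
  obtain ⟨ι₀⟩ := PadicAlgCl.nonempty_ringEquiv_complex 2
  obtain ⟨ι', -, hind⟩ := exists_datum_forall_mem_iff 2 ι₀ hK h𝔭
  ------------------------------------------------------------------ socket FIRST (it carries torsion), frame
  have hctl := hCtl₀ (W.conductorNorm ℤ) K Dt H ι P rfl hK hHN hLt hP hnt hKoK κ hκ γ 𝔭' h𝔭' he' hf'
  have htors : Module.IsTorsion (IwasawaAlgebra 2) (XAc (W.baseChange K) 2 κ 𝔭' ∅ γ) := by
    obtain ⟨n, hn, -⟩ := hctl
    exact hn.1
  obtain ⟨ΩK, Ωp, Q, hΩK, hΩp, hQ⟩ := hFr (W.conductorNorm ℤ) K Dt rfl hK hHN κ hκ γ 𝔭 h𝔭 he hf ι' hind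
  ------------------------------------------------------------------ ranks of the pair and the twin
  have h2 : Module.finrank ℚ K = 2 := hK.1
  haveI : (W.baseChange K).IsGloballyMinimal := W.isGloballyMinimal_baseChange_of_satisfiesHeegnerHypothesis K h2 hHN
  have hD0 : (NumberField.discr K : ℚ) ≠ 0 := by exact_mod_cast NumberField.discr_ne_zero K
  haveI hEt : (W.quadraticTwist (NumberField.discr K : ℚ)).IsElliptic := W.isElliptic_quadraticTwist hD0
  have hrd0 : (W.quadraticTwist (NumberField.discr K : ℚ)).analyticRank = 0 :=
    ((W.quadraticTwist (NumberField.discr K : ℚ)).analyticRank_eq_zero_iff_holds (hmod _)).mpr hLt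
  have hrK : (W.baseChange K).analyticRank = 1 :=
    (Summit.BirchSwinnertonDyer.Rank1Residual.P2.analyticRank_baseChange_eq_one_iff W K hmod h2).mpr (Or.inl ⟨hr, hrd0⟩)
  obtain ⟨Cd, hCd⟩ := hasGlobalMinimalModel_rat_holds (W.quadraticTwist (NumberField.discr K : ℚ))
  haveI : (Cd • W.quadraticTwist (NumberField.discr K : ℚ)).IsGloballyMinimal := hCd
  have hWd : BSDp (Cd • W.quadraticTwist (NumberField.discr K : ℚ)) 2 :=
    hTw (W.conductorNorm ℤ) K (Cd • W.quadraticTwist (NumberField.discr K : ℚ)) rfl hK hHN ⟨Cd, rfl⟩ hLt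
  have hrW : W.analyticRank ≤ 1 := by rw [hr]
  have hrd : (Cd • W.quadraticTwist (NumberField.discr K : ℚ)).analyticRank ≤ 1 := by
    rw [analyticRank_smul, hrd0]; exact zero_le_one
  ------------------------------------------------------------------ the one-sided `K`-side input and the one-sided descent
  have hLo₁ := hLo (W.conductorNorm ℤ) K Dt rfl hK hHN κ hκ γ 𝔭 h𝔭 he hf 𝔭' h𝔭' hne ι' hind ΩK Ωp Q hΩK hΩp hQ htors
  have hKlo := lowerOver_of_lowerDivisibility_two hL hmod W K κ γ Dt H ι P (hGZ _ W K) hKoK rfl h4N hK hd4 hHN hκ hP hnt hrk hrK 𝔭 h𝔭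
    he hf 𝔭' h𝔭' he' hf' ι' hind hΩK hΩp hQ hLo₁ hctl
  exact missingLowerBoundAt_of_lowerOver_of_bsdp_twist W 2 K (Cd • W.quadraticTwist (NumberField.discr K : ℚ)) (W.baseChange K)
    hGZK hmod hMilne hrW h2 ⟨Cd, rfl⟩ hrd ⟨1, one_smul _ _⟩ hKlo hWd

end Summit.BirchSwinnertonDyer.BirchSwinnertonDyer.Theorems.PrintCf2.EisensteinTwo

end
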